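import Summits.MatrixMultiplication.MatrixMultiplication.Theorems.EdgePencilAsymptoticRank
import HarnessLib

/-!
# Blind maximal points: the exact two-sided dual reading of the leaf `TetraExcessZero` and of every rung
# of the sixth-edge ladder on the 4-party asymptotic spectrum, and the E-coordinates

Support kernel for `stmt-MatrixMultiplication-26697` (`TetraExcessZero : ω(K₄) ≤ ω(2,1,2)`, route
`TetrahedronCarving`; cut of record `closes (TetraExcessZero) (TetraPlusTwo) : ω = 2`, UNCHANGED; lineage
`decomp-mm-lens-6`, generation 44; sequel of `EdgePencilAsymptoticRank`). No item is added or changed; no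
definition is introduced. Notation as there: `W_n^{(e)} = sixTetra F n e`, `D_n = W_n^{(1)}`, `T(K₄)_n = tetra F n`,
`P_e = (a ↦ [a 0 = a 1])` on `(Fin 4 → Fin e)` (the `EPR₀₁`-pair of bond `e` with flat legs `2, 3`;
`φ[W_n^{(e)}] = φ[P_e]·φ[D_n]`, `EdgePencilPairFactor.spectrum_sixTetra_eq_pair_mul`), `X₄(F) =
DTensorClass.asymptoticSpectrumDTensors F 2`, `[t] = DTensorClass.mk t`, `R̃ = asympRankOf (· ≤ ·)`,
`χ(δ) = omegaSix F δ`, `ψ = ω(2,1,2)`, `ω(K₄) = omegaTetra F`.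

§18 THE EXACT TWO-SIDED DUAL READING (`sixRung_iff_exists_blind_maximal`,
`tetraExcessZero_iff_exists_blind_maximal`, `…_pair_eq_one`; the one-sided sufficient half was
`EdgePencilDualReading.tetraExcessZero_of_maximal_of_blind`, generation 40), `2 ≤ n`, `1 ≤ e ≤ n`:

  `χ(log_n e) ≤ ψ   ⟺ ∃ φ ∈ X₄(F), φ[W_n^{(e)}] = R̃[W_n^{(e)}] ∧ φ[W_n^{(e)}] = φ[D_n]`
  `TetraExcessZero  ⟺ ∃ φ ∈ X₄(ℂ), φ[T(K₄)_n] = R̃[T(K₄)_n] ∧ φ[P_n] = 1`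

— a rung holds iff SOME `W`-MAXIMAL spectral point is BLIND to edge `01` (`φ[W] = φ[D_n] ⟺ φ[P_e] = 1`,
`blind_iff_pair_eq_one`), and then EVERY `D_n`-maximal point is `W`-maximal and blind
(`maximal_and_blind_of_sixRung`, `maximal_and_blind_of_tetraExcessZero`). (`⟹`: a `D_n`-maximiser `φ°`
exists by compactness and `φ°[D_n] = R̃[D_n] ≥ R̃[W] ≥ φ°[W] ≥ φ°[D_n]`; `⟸`: `R̃[W] = φ[W] = φ[D_n] ≤ R̃[D_n]`.)
Contrast with the tropical form of the flat-summand purchase (`EdgePencilPairFactor.trop_iff_blind_or_subflat`: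
EVERY point seeing edge `01` is subflat): «∀ seeing ⟹ subflat» implies «∃ maximal blind» (a seeing maximiser
would give `R̃[W] ≤ n⁴ ≤ n^{ψ} = R̃[D_n]`), never conversely — the purchase is the STRONGER statement.
The ALL-POINTS form (`excessZero_iff_forall_spectrum`, recorded untyped in generation 40):
`TetraExcessZero ⟺ ∀ φ ∈ X₄(ℂ), φ[T(K₄)_n] ≤ n^{ψ}`.

§19 E-COORDINATES (`exists_spectrum_apply_tetra_eq_rpow_omegaTetra` &c., `logb_spectrum_tetra_le_omegaTetra`):
at every base `n ≥ 2`, `ω(K₄) = max_{φ ∈ X₄} log_n φ[T(K₄)_n]`, `ψ = max_φ log_n φ[D_n]`,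
`χ(log_n e) = max_φ log_n φ[W_n^{(e)}]`, each maximum attained.

References: Strassen 1988, Thm. 3.8 [Strassen1988]; Zuiddam 2018, Thm. 2.12, Cor. 2.13 [Zuiddam2018];
Christandl–Vrana–Zuiddam 2023, Thm. 1.1, Prop. 1.6 [ChristandlVranaZuiddam2023]; Christandl–Vrana–Zuiddam,
arXiv:1609.07476, §1.1 [ChristandlVranaZuiddam2016]. No `sorry`, no new axiom, no instance, no notation,
no definition.
-/

noncomputable section

set_option linter.dupNamespace false

open Filter Finset Literature.Computability.AlgebraicComplexity
open Summit.MatrixMultiplication.MatrixMultiplication.Theorems.TetrahedronTensor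
open Summit.MatrixMultiplication.MatrixMultiplication.Theorems.TetraDiagonal
open Summit.MatrixMultiplication.MatrixMultiplication.Theses.TetrahedronCarving

namespace Summit.MatrixMultiplication.MatrixMultiplication.Theorems.EdgePencil


/-! ## §18 The exact two-sided dual reading: blind maximal points -/

section Dual

variable (F : Type) [Field F]

/-- **BLIND ⟺ PAIR-VALUE ONE**: `φ[W_n^{(e)}] = φ[D_n] ⟺ φ[P_e] = 1` (`1 ≤ n`, `e ≤ n`;
`φ[W] = φ[P_e]·φ[D_n]`, `φ[D_n] ≥ 1`). [cite: Zuiddam2018, Thm. 2.12] -/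
theorem blind_iff_pair_eq_one {n e : ℕ} (hn : 1 ≤ n) (he : e ≤ n) {φ : DTensorClass F 4 → ℝ}
    (hφ : φ ∈ DTensorClass.asymptoticSpectrumDTensors F 2) :
    φ (DTensorClass.mk (sixTetra F n e)) = φ (DTensorClass.mk (sixTetra F n 1)) ↔
      φ (DTensorClass.mk (fun a : Fin 4 → Fin e => (ind (a 0 = a 1) : F))) = 1 := by
  rw [spectrum_sixTetra_eq_pair_mul hn he hφ]
  have hD : 0 < φ (DTensorClass.mk (sixTetra F n 1)) :=
    lt_of_lt_of_le one_pos (one_le_spectrum_sixTetra hn le_rfl hφ)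
  constructor
  · intro h
    have h' : φ (DTensorClass.mk (fun a : Fin 4 → Fin e => (ind (a 0 = a 1) : F))) *
        φ (DTensorClass.mk (sixTetra F n 1)) = 1 * φ (DTensorClass.mk (sixTetra F n 1)) := by
      rw [one_mul]; exact h
    exact mul_right_cancel₀ hD.ne' h'
  · intro h
    rw [h, one_mul]

/-- **THE RUNG ⟹ every `D_n`-maximal point is `W`-maximal and blind** (`2 ≤ n`, `1 ≤ e ≤ n`):
`φ[D_n] = R̃[D_n] ≥ R̃[W] ≥ φ[W] ≥ φ[D_n]`. [cite: Zuiddam2018, Cor. 2.13] -/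
theorem maximal_and_blind_of_sixRung {n e : ℕ} (hn : 2 ≤ n) (he1 : 1 ≤ e) (he : e ≤ n)
    (h : omegaSix F (Real.logb n e) ≤ omegaRect F 2 1 2) {φ : DTensorClass F 4 → ℝ}
    (hφ : φ ∈ DTensorClass.asymptoticSpectrumDTensors F 2)
    (hφD : φ (DTensorClass.mk (sixTetra F n 1)) =
      asympRankOf (fun x y : DTensorClass F 4 => x ≤ y) (DTensorClass.mk (sixTetra F n 1))) :
    φ (DTensorClass.mk (sixTetra F n e)) =
        asympRankOf (fun x y : DTensorClass F 4 => x ≤ y) (DTensorClass.mk (sixTetra F n e)) ∧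
      φ (DTensorClass.mk (sixTetra F n e)) = φ (DTensorClass.mk (sixTetra F n 1)) := by
  rw [sixRung_iff_asympRank_le F hn he1 he] at h
  have h1 : φ (DTensorClass.mk (sixTetra F n 1)) ≤ φ (DTensorClass.mk (sixTetra F n e)) :=
    spectrum_diamond_le_sixTetra he1 hφ
  have h2 : φ (DTensorClass.mk (sixTetra F n e)) ≤
      asympRankOf (fun x y : DTensorClass F 4 => x ≤ y) (DTensorClass.mk (sixTetra F n e)) :=
    DTensorClass.le_asympRankOf hφ _
  refine ⟨le_antisymm h2 ?_, le_antisymm ?_ h1⟩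
  · calc asympRankOf (fun x y : DTensorClass F 4 => x ≤ y) (DTensorClass.mk (sixTetra F n e))
        ≤ asympRankOf (fun x y : DTensorClass F 4 => x ≤ y) (DTensorClass.mk (sixTetra F n 1)) := h
      _ = φ (DTensorClass.mk (sixTetra F n 1)) := hφD.symm
      _ ≤ φ (DTensorClass.mk (sixTetra F n e)) := h1
  · calc φ (DTensorClass.mk (sixTetra F n e))
        ≤ asympRankOf (fun x y : DTensorClass F 4 => x ≤ y) (DTensorClass.mk (sixTetra F n e)) := h2
      _ ≤ asympRankOf (fun x y : DTensorClass F 4 => x ≤ y) (DTensorClass.mk (sixTetra F n 1)) := h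
      _ = φ (DTensorClass.mk (sixTetra F n 1)) := hφD.symm

/-- **THE EXACT DUAL READING OF A RUNG**: `χ(log_n e) ≤ ψ` iff SOME `W_n^{(e)}`-maximal spectral point is
blind to edge `01` (`2 ≤ n`, `1 ≤ e ≤ n`). (`⟹`: a `D_n`-maximiser, which exists by compactness;
`⟸`: `R̃[W] = φ[W] = φ[D_n] ≤ R̃[D_n]`.) [cite: Zuiddam2018, Cor. 2.13] -/
theorem sixRung_iff_exists_blind_maximal {n e : ℕ} (hn : 2 ≤ n) (he1 : 1 ≤ e) (he : e ≤ n) :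
    omegaSix F (Real.logb n e) ≤ omegaRect F 2 1 2 ↔
      ∃ φ ∈ DTensorClass.asymptoticSpectrumDTensors F 2,
        φ (DTensorClass.mk (sixTetra F n e)) =
            asympRankOf (fun x y : DTensorClass F 4 => x ≤ y) (DTensorClass.mk (sixTetra F n e)) ∧
          φ (DTensorClass.mk (sixTetra F n e)) = φ (DTensorClass.mk (sixTetra F n 1)) := by
  constructor
  · intro h
    obtain ⟨φ, hφ, hφD⟩ :=
      DTensorClass.exists_mem_spectrum_apply_eq_asympRankOf (DTensorClass.mk (sixTetra F n 1))
    exact ⟨φ, hφ, maximal_and_blind_of_sixRung F hn he1 he h hφ hφD⟩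
  · rintro ⟨φ, hφ, hW, hD⟩
    rw [sixRung_iff_asympRank_le F hn he1 he, ← hW, hD]
    exact DTensorClass.le_asympRankOf hφ _

/-- **… in pair form**: `χ(log_n e) ≤ ψ ⟺ ∃ φ ∈ X₄(F)`, `W_n^{(e)}`-maximal, with `φ[P_e] = 1`.
[cite: Zuiddam2018, Cor. 2.13] -/
theorem sixRung_iff_exists_maximal_pair_eq_one {n e : ℕ} (hn : 2 ≤ n) (he1 : 1 ≤ e) (he : e ≤ n) :
    omegaSix F (Real.logb n e) ≤ omegaRect F 2 1 2 ↔
      ∃ φ ∈ DTensorClass.asymptoticSpectrumDTensors F 2,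
        φ (DTensorClass.mk (sixTetra F n e)) =
            asympRankOf (fun x y : DTensorClass F 4 => x ≤ y) (DTensorClass.mk (sixTetra F n e)) ∧
          φ (DTensorClass.mk (fun a : Fin 4 → Fin e => (ind (a 0 = a 1) : F))) = 1 := by
  rw [sixRung_iff_exists_blind_maximal F hn he1 he]
  refine exists_congr fun φ => ?_
  refine and_congr_right fun hφ => and_congr_right fun _ => ?_
  exact blind_iff_pair_eq_one F (by omega) he hφ

/-- **`ExcessZero` dual, one base**: `ω(K₄) ≤ ψ ⟺` some `T(K₄)_n`-maximal point is blind to edge `01`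
(`2 ≤ n`). [cite: Zuiddam2018, Cor. 2.13] -/
theorem excessZero_iff_exists_blind_maximal {n : ℕ} (hn : 2 ≤ n) :
    omegaTetra F ≤ omegaRect F 2 1 2 ↔
      ∃ φ ∈ DTensorClass.asymptoticSpectrumDTensors F 2,
        φ (DTensorClass.mk (tetra F n)) =
            asympRankOf (fun x y : DTensorClass F 4 => x ≤ y) (DTensorClass.mk (tetra F n)) ∧
          φ (DTensorClass.mk (tetra F n)) = φ (DTensorClass.mk (sixTetra F n 1)) := by
  have hn1' : (1 : ℝ) < n := by exact_mod_cast (show 1 < n by omega)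
  have h := sixRung_iff_exists_blind_maximal F hn (by omega : 1 ≤ n) le_rfl
  rwa [Real.logb_self_eq_one hn1', omegaSix_one, sixTetra_of_le le_rfl] at h

/-- **THE EXACT DUAL READING OF THE LEAF, BY NAME**: `TetraExcessZero` iff some `T(K₄)_n`-MAXIMAL point of
`X₄(ℂ)` is BLIND to edge `01` (`φ[T(K₄)_n] = φ[D_n]`), at any single base `n ≥ 2`; the one-sided half was
`EdgePencilDualReading.tetraExcessZero_of_maximal_of_blind`. [cite: Strassen1988, Thm. 3.8] -/
theorem tetraExcessZero_iff_exists_blind_maximal {n : ℕ} (hn : 2 ≤ n) :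
    TetraExcessZero ↔
      ∃ φ ∈ DTensorClass.asymptoticSpectrumDTensors ℂ 2,
        φ (DTensorClass.mk (tetra ℂ n)) =
            asympRankOf (fun x y : DTensorClass ℂ 4 => x ≤ y) (DTensorClass.mk (tetra ℂ n)) ∧
          φ (DTensorClass.mk (tetra ℂ n)) = φ (DTensorClass.mk (sixTetra ℂ n 1)) :=
  excessZero_iff_exists_blind_maximal ℂ hn

/-- **… in pair form**: `TetraExcessZero ⟺ ∃ φ ∈ X₄(ℂ)`, `T(K₄)_n`-maximal, with `φ[P_n] = 1`
(`2 ≤ n`). [cite: Strassen1988, Thm. 3.8] -/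
theorem tetraExcessZero_iff_exists_maximal_pair_eq_one {n : ℕ} (hn : 2 ≤ n) :
    TetraExcessZero ↔
      ∃ φ ∈ DTensorClass.asymptoticSpectrumDTensors ℂ 2,
        φ (DTensorClass.mk (tetra ℂ n)) =
            asympRankOf (fun x y : DTensorClass ℂ 4 => x ≤ y) (DTensorClass.mk (tetra ℂ n)) ∧
          φ (DTensorClass.mk (fun a : Fin 4 → Fin n => (ind (a 0 = a 1) : ℂ))) = 1 := by
  have hn1' : (1 : ℝ) < n := by exact_mod_cast (show 1 < n by omega)
  have h := sixRung_iff_exists_maximal_pair_eq_one ℂ hn (by omega : 1 ≤ n) le_rfl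
  rw [Real.logb_self_eq_one hn1', omegaSix_one, sixTetra_of_le le_rfl] at h
  exact h

/-- **THE LEAF ⟹ every `D_n`-maximal point of `X₄(ℂ)` is `T(K₄)_n`-maximal and blind** (`2 ≤ n`).
[cite: Strassen1988, Thm. 3.8] -/
theorem maximal_and_blind_of_tetraExcessZero (hE : TetraExcessZero) {n : ℕ} (hn : 2 ≤ n)
    {φ : DTensorClass ℂ 4 → ℝ} (hφ : φ ∈ DTensorClass.asymptoticSpectrumDTensors ℂ 2)
    (hφD : φ (DTensorClass.mk (sixTetra ℂ n 1)) =
      asympRankOf (fun x y : DTensorClass ℂ 4 => x ≤ y) (DTensorClass.mk (sixTetra ℂ n 1))) :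
    φ (DTensorClass.mk (tetra ℂ n)) =
        asympRankOf (fun x y : DTensorClass ℂ 4 => x ≤ y) (DTensorClass.mk (tetra ℂ n)) ∧
      φ (DTensorClass.mk (tetra ℂ n)) = φ (DTensorClass.mk (sixTetra ℂ n 1)) := by
  have hn1' : (1 : ℝ) < n := by exact_mod_cast (show 1 < n by omega)
  have hE' : omegaSix ℂ (Real.logb n n) ≤ omegaRect ℂ 2 1 2 := by
    rw [Real.logb_self_eq_one hn1', omegaSix_one]
    exact hE
  have h := maximal_and_blind_of_sixRung ℂ hn (by omega : 1 ≤ n) le_rfl hE' hφ hφD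
  rwa [sixTetra_of_le le_rfl] at h

/-- **THE ALL-POINTS FORM** (recorded untyped in generation 40): `ω(K₄) ≤ ψ ⟺ ∀ φ ∈ X₄(F), φ[T(K₄)_n] ≤ n^{ψ}`
(`2 ≤ n`). [cite: Strassen1988, Thm. 3.8] -/
theorem excessZero_iff_forall_spectrum {n : ℕ} (hn : 2 ≤ n) :
    omegaTetra F ≤ omegaRect F 2 1 2 ↔
      ∀ φ ∈ DTensorClass.asymptoticSpectrumDTensors F 2,
        φ (DTensorClass.mk (tetra F n)) ≤ (n : ℝ) ^ omegaRect F 2 1 2 := by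
  rw [excessZero_iff_asympRank_le F hn, ← rpow_omegaRect_eq_asympRank_diamond F hn]
  constructor
  · intro h φ hφ
    exact (DTensorClass.le_asympRankOf hφ _).trans h
  · intro h
    obtain ⟨φ, hφ, hφeq⟩ :=
      DTensorClass.exists_mem_spectrum_apply_eq_asympRankOf (DTensorClass.mk (tetra F n))
    rw [← hφeq]
    exact h φ hφ

/-- **`TetraExcessZero ⟺ ∀ φ ∈ X₄(ℂ), φ[T(K₄)_n] ≤ n^{ψ}`** (`2 ≤ n`). [cite: Strassen1988, Thm. 3.8] -/
theorem tetraExcessZero_iff_forall_spectrum {n : ℕ} (hn : 2 ≤ n) :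
    TetraExcessZero ↔
      ∀ φ ∈ DTensorClass.asymptoticSpectrumDTensors ℂ 2,
        φ (DTensorClass.mk (tetra ℂ n)) ≤ (n : ℝ) ^ omegaRect ℂ 2 1 2 :=
  excessZero_iff_forall_spectrum ℂ hn

end Dual

/-! ## §19 E-coordinates: the exponents are attained maxima of point values -/

section Coordinates

variable (F : Type) [Field F]

/-- **`ω(K₄)` is attained**: some `φ ∈ X₄(F)` has `φ[T(K₄)_n] = n^{ω(K₄)}` (`2 ≤ n`); with
`spectrum_tetra_le_rpow_omegaTetra`, `ω(K₄) = max_{φ ∈ X₄} log_n φ[T(K₄)_n]`. [cite: Zuiddam2018, Cor. 2.13] -/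
theorem exists_spectrum_apply_tetra_eq_rpow_omegaTetra {n : ℕ} (hn : 2 ≤ n) :
    ∃ φ ∈ DTensorClass.asymptoticSpectrumDTensors F 2,
      φ (DTensorClass.mk (tetra F n)) = (n : ℝ) ^ omegaTetra F := by
  obtain ⟨φ, hφ, hφeq⟩ :=
    DTensorClass.exists_mem_spectrum_apply_eq_asympRankOf (DTensorClass.mk (tetra F n))
  exact ⟨φ, hφ, by rw [hφeq, rpow_omegaTetra_eq_asympRank F hn]⟩

/-- **`ψ` is attained**: some `φ ∈ X₄(F)` has `φ[D_n] = n^{ψ}` (`2 ≤ n`). [cite: Zuiddam2018, Cor. 2.13] -/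
theorem exists_spectrum_apply_diamond_eq_rpow_omegaRect {n : ℕ} (hn : 2 ≤ n) :
    ∃ φ ∈ DTensorClass.asymptoticSpectrumDTensors F 2,
      φ (DTensorClass.mk (sixTetra F n 1)) = (n : ℝ) ^ omegaRect F 2 1 2 := by
  obtain ⟨φ, hφ, hφeq⟩ :=
    DTensorClass.exists_mem_spectrum_apply_eq_asympRankOf (DTensorClass.mk (sixTetra F n 1))
  exact ⟨φ, hφ, by rw [hφeq, rpow_omegaRect_eq_asympRank_diamond F hn]⟩

/-- **`χ(log_n e)` is attained**: some `φ ∈ X₄(F)` has `φ[W_n^{(e)}] = n^{χ(log_n e)}` (`2 ≤ n`,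
`1 ≤ e ≤ n`). [cite: Zuiddam2018, Cor. 2.13] -/
theorem exists_spectrum_apply_sixTetra_eq_rpow_omegaSix {n e : ℕ} (hn : 2 ≤ n) (he1 : 1 ≤ e)
    (he : e ≤ n) :
    ∃ φ ∈ DTensorClass.asymptoticSpectrumDTensors F 2,
      φ (DTensorClass.mk (sixTetra F n e)) = (n : ℝ) ^ omegaSix F (Real.logb n e) := by
  obtain ⟨φ, hφ, hφeq⟩ :=
    DTensorClass.exists_mem_spectrum_apply_eq_asympRankOf (DTensorClass.mk (sixTetra F n e))
  exact ⟨φ, hφ, by rw [hφeq, rpow_omegaSix_logb_eq_asympRank F hn he1 he]⟩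

/-- `log_n φ[T(K₄)_n] ≤ ω(K₄)` for every `φ ∈ X₄(F)` (`2 ≤ n`). [cite: Strassen1988, Thm. 3.8] -/
theorem logb_spectrum_tetra_le_omegaTetra {n : ℕ} (hn : 2 ≤ n) {φ : DTensorClass F 4 → ℝ}
    (hφ : φ ∈ DTensorClass.asymptoticSpectrumDTensors F 2) :
    Real.logb n (φ (DTensorClass.mk (tetra F n))) ≤ omegaTetra F := by
  have hn1' : (1 : ℝ) < n := by exact_mod_cast (show 1 < n by omega)
  have h0 : 0 < φ (DTensorClass.mk (tetra F n)) := by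
    have h := one_le_spectrum_sixTetra (F := F) (by omega : 1 ≤ n) (by omega : 1 ≤ n) hφ
    rw [sixTetra_of_le le_rfl] at h
    linarith
  rw [Real.logb_le_iff_le_rpow hn1' h0]
  exact spectrum_tetra_le_rpow_omegaTetra F (by omega) hφ

/-- `log_n φ[D_n] ≤ ψ` for every `φ ∈ X₄(F)` (`2 ≤ n`). [cite: Strassen1988, Thm. 3.8] -/
theorem logb_spectrum_diamond_le_omegaRect {n : ℕ} (hn : 2 ≤ n) {φ : DTensorClass F 4 → ℝ}
    (hφ : φ ∈ DTensorClass.asymptoticSpectrumDTensors F 2) :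
    Real.logb n (φ (DTensorClass.mk (sixTetra F n 1))) ≤ omegaRect F 2 1 2 := by
  have hn1' : (1 : ℝ) < n := by exact_mod_cast (show 1 < n by omega)
  have h0 : 0 < φ (DTensorClass.mk (sixTetra F n 1)) :=
    lt_of_lt_of_le one_pos (one_le_spectrum_sixTetra (by omega : 1 ≤ n) le_rfl hφ)
  rw [Real.logb_le_iff_le_rpow hn1' h0]
  exact spectrum_diamond_le_rpow_omegaRect F (by omega) hφ

end Coordinates

end Summit.MatrixMultiplication.MatrixMultiplication.Theorems.EdgePencil

end
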